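import Mathlib.Analysis.Normed.Module.FiniteDimension
import Mathlib.NumberTheory.Padics.Complex
import HarnessLib

/-!
# Lattice lemma for the closure form of Leopoldt: small `ℤ`-combinations of independent vectors
# have coefficients divisible by a high power of `p`

Support file 8 of the brick «(b) weak Leopoldt over `𝔎_∞`: `Ē_∞ ↪ U_v`» (cell bsd-print-cf2, LEAD
ruling B23 §4 (b)) for crux `PrintCf2RubinValueTwo.TwoVariableMainConjAtSplitTwo`
(stmt-BirchSwinnertonDyer-23720). Namespace `…Theorems.PrintCf2.LeopoldtAtV`.

The `𝔭`-adic Leopoldt theorem of the cell (`linearIndependent_padicLog_of_linearIndependent_holds`,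
file `…LeopoldtAtVFamily`) says that the logarithm vectors `Λ(u_j) ∈ ℚ̄_p^{Gal(F/K)}` of
`ℤ`-independent units are `ℚ̄_p`-linearly independent. To turn this into the CLOSURE statement on
the semi-local units (`ℰ(F) ∩ U^{(k)}(F) ⊆ ℰ(F)^{pⁿ}·μ` for `k ≫ n`, file `…LeopoldtClosure`) one
needs the elementary functional-analytic fact proved here: over a complete non-trivially normed
field `𝕜`, a linearly independent finite family `Λ` in a normed space admits a constant `C` with
`‖a‖ ≤ C · ‖∑ aᵢ • Λᵢ‖` (the coordinate map of a finite-dimensional subspace is continuous), hence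
(`𝕜 = ℚ_p`): for every `n` there is `δ > 0` such that an INTEGER combination `∑ bᵢ • Λᵢ` of norm
`< δ` has all `bᵢ` divisible by `pⁿ` (`‖(b : ℚ_p)‖ ≤ p⁻ⁿ ↔ pⁿ ∣ b`). The last section restricts
scalars from `ℚ̄_p = PadicAlgCl p` to `ℚ_p`.

References: L. C. Washington, *Introduction to Cyclotomic Fields*, GTM 83, §5.5 (proof of
Thm. 5.31: "the `ℤ_p`-rank of the closure equals the rank of the matrix of logarithms");
folklore (equivalence of norms on finite-dimensional spaces).
-/

noncomputable section

set_option linter.dupNamespace false -- `Summit.BirchSwinnertonDyer.BirchSwinnertonDyer` (summit = problem) is the tree's layout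
set_option autoImplicit false

open Module

namespace Summit.BirchSwinnertonDyer.BirchSwinnertonDyer.Theorems.PrintCf2.LeopoldtAtV

/-! ### §1. Coordinates of a linearly independent finite family are bounded by the norm -/

section General

variable {𝕜 : Type*} [NontriviallyNormedField 𝕜]
  {V : Type*} [NormedAddCommGroup V] [NormedSpace 𝕜 V] {ι : Type*} [Fintype ι]

/-- The combination map `a ↦ ∑ aᵢ • Λᵢ` of a linearly independent finite family is injective.
[folklore] -/
theorem injective_linearCombination_of_linearIndependent {Λ : ι → V}
    (hΛ : LinearIndependent 𝕜 Λ) : Function.Injective (Fintype.linearCombination 𝕜 Λ) := by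
  rw [← LinearMap.ker_eq_bot, LinearMap.ker_eq_bot']
  intro a ha
  rw [Fintype.linearCombination_apply] at ha
  funext i
  exact Fintype.linearIndependent_iff.mp hΛ a ha i

/-- **Coordinates are bounded by the norm of the combination**: for a linearly independent finite
family `Λ` in a normed space over a complete field there is `C > 0` with `‖a‖ ≤ C·‖∑ᵢ aᵢ • Λᵢ‖`
for every coefficient vector `a` (the inverse of the finite-dimensional coordinate isomorphism is
continuous). [folklore] -/
theorem exists_norm_le_mul_norm_sum_smul [CompleteSpace 𝕜] {Λ : ι → V} (hΛ : LinearIndependent 𝕜 Λ) :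
    ∃ C : ℝ, 0 < C ∧ ∀ a : ι → 𝕜, ‖a‖ ≤ C * ‖∑ i, a i • Λ i‖ := by
  set T : (ι → 𝕜) →ₗ[𝕜] V := Fintype.linearCombination 𝕜 Λ with hT
  have hTinj : Function.Injective T := injective_linearCombination_of_linearIndependent hΛ
  -- the coordinate isomorphism onto the range, made continuous (finite-dimensional domain)
  let e : (ι → 𝕜) ≃L[𝕜] LinearMap.range T := (LinearEquiv.ofInjective T hTinj).toContinuousLinearEquiv
  refine ⟨max ‖(e.symm : LinearMap.range T →L[𝕜] (ι → 𝕜))‖ 1, lt_max_of_lt_right one_pos,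
    fun a ↦ ?_⟩
  have hea : ((e a : LinearMap.range T) : V) = ∑ i, a i • Λ i := by
    change ((LinearEquiv.ofInjective T hTinj a : LinearMap.range T) : V) = _
    rw [LinearEquiv.ofInjective_apply, hT, Fintype.linearCombination_apply]
  calc ‖a‖ = ‖(e.symm : LinearMap.range T →L[𝕜] (ι → 𝕜)) (e a)‖ := by
        rw [ContinuousLinearEquiv.coe_coe, ContinuousLinearEquiv.symm_apply_apply]
    _ ≤ ‖(e.symm : LinearMap.range T →L[𝕜] (ι → 𝕜))‖ * ‖e a‖ := ContinuousLinearMap.le_opNorm _ _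
    _ ≤ max ‖(e.symm : LinearMap.range T →L[𝕜] (ι → 𝕜))‖ 1 * ‖∑ i, a i • Λ i‖ := by
        rw [← hea]
        exact mul_le_mul_of_nonneg_right (le_max_left _ _) (norm_nonneg _)

end General

/-! ### §2. Over `ℚ_p`: small integer combinations have coefficients divisible by `pⁿ` -/

section Padic

variable {p : ℕ} [Fact p.Prime] {V : Type*} [NormedAddCommGroup V] [NormedSpace ℚ_[p] V]
  {ι : Type*} [Fintype ι]

/-- **Lattice lemma**: for a `ℚ_p`-linearly independent finite family `Λ` and every `n` there is
`δ > 0` such that every INTEGER combination `∑ᵢ bᵢ • Λᵢ` of norm `< δ` has `pⁿ ∣ bᵢ` for all `i`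
(`pⁿ L` is open in the `ℤ_p`-lattice `L = ∑ ℤ_p Λᵢ`). [cite: Washington1997, §5.5 (proof of Thm. 5.31)] -/
theorem exists_forall_pow_dvd_of_norm_sum_zsmul_lt {Λ : ι → V} (hΛ : LinearIndependent ℚ_[p] Λ)
    (n : ℕ) : ∃ δ : ℝ, 0 < δ ∧ ∀ b : ι → ℤ, ‖∑ i, b i • Λ i‖ < δ → ∀ i, (p ^ n : ℤ) ∣ b i := by
  obtain ⟨C, hC, hbound⟩ := exists_norm_le_mul_norm_sum_smul hΛ
  have hp : 0 < (p : ℝ) := by exact_mod_cast (Fact.out : p.Prime).pos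
  refine ⟨(p : ℝ) ^ (-n : ℤ) / C, div_pos (zpow_pos hp _) hC, fun b hb i ↦ ?_⟩
  rw [← Padic.norm_int_le_pow_iff_dvd]
  have hsum : ∑ j, ((b j : ℤ) : ℚ_[p]) • Λ j = ∑ j, b j • Λ j :=
    Finset.sum_congr rfl fun j _ ↦ Int.cast_smul_eq_zsmul ℚ_[p] (b j) (Λ j)
  have h1 : ‖fun j ↦ ((b j : ℤ) : ℚ_[p])‖ ≤ C * ‖∑ j, b j • Λ j‖ := by
    rw [← hsum]; exact hbound _
  have h2 : C * ‖∑ j, b j • Λ j‖ ≤ (p : ℝ) ^ (-n : ℤ) := by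
    have := (lt_div_iff₀ hC).mp hb
    rw [mul_comm] at this
    exact this.le
  exact (norm_le_pi_norm (fun j ↦ ((b j : ℤ) : ℚ_[p])) i).trans (h1.trans h2)

end Padic

/-! ### §3. Vectors in `ℚ̄_p^G`: restriction of scalars from `ℚ̄_p` to `ℚ_p` -/

section AlgCl

variable {p : ℕ} [Fact p.Prime] {G : Type*} {ι : Type*}

/-- `ℚ̄_p`-linearly independent vectors of `ℚ̄_p^G` are `ℚ_p`-linearly independent. [folklore] -/
theorem linearIndependent_padic_of_padicAlgCl {Λ : ι → G → PadicAlgCl p}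
    (hΛ : LinearIndependent (PadicAlgCl p) Λ) : LinearIndependent ℚ_[p] Λ := by
  refine hΛ.restrict_scalars ?_
  intro r s hrs
  simpa [Algebra.algebraMap_eq_smul_one] using
    (algebraMap ℚ_[p] (PadicAlgCl p)).injective (by
      rw [Algebra.algebraMap_eq_smul_one, Algebra.algebraMap_eq_smul_one]; exact hrs)

/-- **Lattice lemma in `ℚ̄_p^G`**: for `ℚ̄_p`-independent vectors `Λᵢ ∈ ℚ̄_p^G` (sup norm of the
spectral norm) and every `n` there is `δ > 0` with: `‖∑ᵢ bᵢ • Λᵢ‖ < δ`, `bᵢ ∈ ℤ` ⟹ `pⁿ ∣ bᵢ`.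
[cite: Washington1997, §5.5 (proof of Thm. 5.31)] -/
theorem exists_forall_pow_dvd_of_norm_sum_zsmul_lt_algCl [Fintype G] [Fintype ι]
    {Λ : ι → G → PadicAlgCl p} (hΛ : LinearIndependent (PadicAlgCl p) Λ) (n : ℕ) :
    ∃ δ : ℝ, 0 < δ ∧ ∀ b : ι → ℤ, ‖∑ i, b i • Λ i‖ < δ → ∀ i, (p ^ n : ℤ) ∣ b i := by
  obtain ⟨δ, hδ, h⟩ := exists_forall_pow_dvd_of_norm_sum_zsmul_lt (V := G → PadicAlgCl p)
    (linearIndependent_padic_of_padicAlgCl hΛ) n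
  exact ⟨δ, hδ, h⟩

/-- Coordinate form of the smallness hypothesis: if every coordinate `σ` of `∑ᵢ bᵢ • Λᵢ` has norm
`< δ` then so does the vector (sup norm). [folklore] -/
theorem norm_sum_zsmul_lt_of_forall [Fintype G] [Fintype ι] {Λ : ι → G → PadicAlgCl p}
    {b : ι → ℤ} {δ : ℝ} (hδ : 0 < δ)
    (h : ∀ σ : G, ‖∑ i, b i • Λ i σ‖ < δ) : ‖∑ i, b i • Λ i‖ < δ := by
  rw [pi_norm_lt_iff hδ]
  intro σ
  have : (∑ i, b i • Λ i) σ = ∑ i, b i • Λ i σ := by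
    simp [Finset.sum_apply]
  rw [this]
  exact h σ

end AlgCl

end Summit.BirchSwinnertonDyer.BirchSwinnertonDyer.Theorems.PrintCf2.LeopoldtAtV

end
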